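import Literature.Algebra.Homology.DiscreteRepSubgroupLayers
import Literature.Algebra.Homology.DiscreteRepCoresRes
import Literature.Algebra.Homology.DiscreteRepRestrictionExact
import HarnessLib

/-!
# Restriction to an open subgroup READ ON THE LAYERS of `(d)`: `Res_U ∘ Inf_V = Inf_{V ∩ U} ∘ Res`
# (Serre, *Galois Cohomology* I §2.2 Prop. 8; Harari §4.3 (2)–(3), §1.5)

Topic `Algebra/Homology`; namespace `Literature.Algebra.Homology.DiscreteRep` (layer statements in
`DiscreteRep.LayerColimit`).  Two definitions with bodies (`traceQuotMap U V`, the injection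
`U ⧸ (V ∩ U) →* Γ ⧸ V`; `traceLayerHom U V M`, the identity-on-vectors morphism
`Res_{U⧸(V∩U) → Γ⧸V}(M^V) ⟶ (Res_U M)^{V ∩ U}` of `Rep k (U ⧸ (V ∩ U))`) and theorems; no named fact, no
instance, no `sorry`.  Sequel of `DiscreteRepSubgroupLayers` (door-c6 g15: the trace
`V ∩ U = traceOpenNormalSubgroup U V` of an open normal subgroup `V ≤ Γ` on a subgroup `U`, the trace layers
`(Res_U M)^{V ∩ U}`) and of `DiscreteRepCoresRes` / `DiscreteRepLayerColimitGroupCohomology` (door-c4: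
`extRes`, `inflG`, the dictionary (N1) with Mathlib's `groupCohomology.map`).

THE POINT.  Door-c4's Tate duality theorem asks for the class-formation data of `C ∈ C_Γ` at every open
normal subgroup `U`, in particular the `Res`-form of the invariant axiom `inv_U ∘ Res = [Γ:U] • inv_Γ`
(`DiscreteRepInvariantCores.bijective_inv_comp_extCores`).  The invariants are defined on the finite layers
of the colimit theorem (d); this file says how the RESTRICTION `Res : Extⁿ_{C_Γ}(k, M) → Extⁿ_{C_U}(k, Res_U M)`
(`extRes U`) reads on those layers: for `V ≤ Γ` open normal and `c ∈ Hⁿ(Γ ⧸ V, M^V)`,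

  **`extRes U (Inf_V c) = Inf_{V ∩ U} (Hⁿ(traceQuotMap, traceLayerHom) c)`** (`extRes_inflG`),

i.e. restricting an inflated class is inflating (to `U`, from its layer `U ⧸ (V ∩ U)`) the class restricted
along the injection `U ⧸ (V ∩ U) ↪ Γ ⧸ V` — Mathlib's `groupCohomology.map`, the finite-level restriction
map when `V ≤ U`.  Ingredients: the functor identity `Inf_V ⋙ Res_U = Res_{traceQuotMap} ⋙ Inf_{V∩U}`
(definitional), Mathlib's `Ext.mapExactFunctor` calculus, the tree's `mapExactFunctor_comp_functor`, and
door-c4's dictionary `E ((x.mapExactFunctor (Rep.resFunctor f)).comp (mk₀ φ)) = groupCohomology.map f φ (E x)`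
(`RepExt.extTrivialAddEquivGroupCohomology_mapExactFunctor_comp`).

Written for Route A of the Poitou–Tate programme of crux `stmt-BirchSwinnertonDyer-19295` (cell
`bsd-schneider-ideate`, seat door-c4 gen 16): with `Γ = Γ_F`, `U = Gal(F̄/L)`, `V = Gal(F̄/E)` (`L ⊆ E`) the
right-hand side is the restriction `H²(Gal(E/F), C_E) → H²(Gal(E/L), C_E)` of the idèle class formation, on
which `inv_{E/L} ∘ Res = [L:F] • inv_{E/F}` (door-c5 `classInvAll_classRes`).  HONEST FRAMING: homological
algebra only; no arithmetic statement and no case of BSD is proved here.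

## References
* J.-P. Serre, *Galois Cohomology*, Springer (1997), I §2.2 Proposition 8 and §2.4 (restriction,
  compatibility with the limit over open normal subgroups). [SerreGaloisCohomology1997]
* D. Harari, *Galois Cohomology and Class Field Theory*, Universitext (2020), §1.5 Definition 1.33
  (restriction), §4.3 (2)–(3) (open subgroups of profinite groups). [Harari2020]
-/

noncomputable section

universe u

namespace Literature.Algebra.Homology

namespace DiscreteRep

open CategoryTheory CategoryTheory.Limits CategoryTheory.Abelian

variable {k Γ : Type u} [CommRing k] [Group Γ] [TopologicalSpace Γ] [IsTopologicalGroup Γ]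
  (U : Subgroup Γ) (V : OpenNormalSubgroup Γ) (M : DiscreteRepCat k Γ)

/-! ## §1 The injection `U ⧸ (V ∩ U) →* Γ ⧸ V` -/

omit [IsTopologicalGroup Γ] in
/-- `V ∩ U ≤ V ∘ incl` (the trace is the preimage of `V` under `U ↪ Γ`, definitionally).
[cite: SerreGaloisCohomology1997, I §2.2 Proposition 8] -/
theorem traceOpenNormalSubgroup_le_comap :
    ((traceOpenNormalSubgroup U V : Subgroup U)) ≤ (V : Subgroup Γ).comap U.subtype := fun _ hu => hu

/-- **The homomorphism `U ⧸ (V ∩ U) →* Γ ⧸ V` induced by the inclusion `U ↪ Γ`** (injective; an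
isomorphism onto `U·V ⧸ V`, onto `U ⧸ V ≤ Γ ⧸ V` when `V ≤ U`).
[cite: SerreGaloisCohomology1997, I §2.2 Proposition 8][cite: Harari2020, §4.3 (2)] -/
def traceQuotMap : U ⧸ (traceOpenNormalSubgroup U V : Subgroup U) →* Γ ⧸ (V : Subgroup Γ) :=
  QuotientGroup.map _ _ U.subtype (traceOpenNormalSubgroup_le_comap U V)

omit [IsTopologicalGroup Γ] in
/-- `traceQuotMap [u] = [u]`. [cite: SerreGaloisCohomology1997, I §2.2 Proposition 8] -/
@[simp]
theorem traceQuotMap_mk (u : U) :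
    traceQuotMap U V (QuotientGroup.mk u) = QuotientGroup.mk (u : Γ) := rfl

omit [IsTopologicalGroup Γ] in
/-- `traceQuotMap` is injective (`[u] = 1` in `Γ ⧸ V` means `u ∈ V`, i.e. `u ∈ V ∩ U`).
[cite: SerreGaloisCohomology1997, I §2.2 Proposition 8] -/
theorem traceQuotMap_injective : Function.Injective (traceQuotMap U V) := by
  refine (injective_iff_map_eq_one _).2 fun q hq => ?_
  induction q using QuotientGroup.induction_on with
  | H u =>
    rw [traceQuotMap_mk, QuotientGroup.eq_one_iff] at hq
    exact (QuotientGroup.eq_one_iff u).2 ((mem_traceOpenNormalSubgroup_iff U V u).2 hq)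

omit [IsTopologicalGroup Γ] in
/-- `traceQuotMap ∘ mk = mk ∘ incl` as homomorphisms `U →* Γ ⧸ V`.
[cite: SerreGaloisCohomology1997, I §2.2 Proposition 8] -/
theorem traceQuotMap_comp_mk' :
    (traceQuotMap U V).comp (QuotientGroup.mk' (traceOpenNormalSubgroup U V : Subgroup U)) =
      (QuotientGroup.mk' (V : Subgroup Γ)).comp U.subtype :=
  MonoidHom.ext fun _ => rfl

/-! ## §2 The layer morphism `Res(M^V) ⟶ (Res_U M)^{V ∩ U}` -/

omit [IsTopologicalGroup Γ] in
/-- **The identity-on-vectors morphism `Res_{traceQuotMap}(M^V) ⟶ (Res_U M)^{V ∩ U}`** of representations of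
`U ⧸ (V ∩ U)` (a `V`-invariant vector of `M` is `V ∩ U`-invariant; door-c6 `mem_invariants_traceLayer`).
[cite: SerreGaloisCohomology1997, I §2.2 Proposition 8] -/
def traceLayerHom :
    Rep.res (traceQuotMap U V) ((invariantsQuotFunctor k (V : Subgroup Γ)).obj M) ⟶
      (invariantsQuotFunctor k (traceOpenNormalSubgroup U V : Subgroup U)).obj ((resD k U).obj M) :=
  Rep.ofHom
    ⟨{ toFun := fun x => ⟨x.1, mem_invariants_traceLayer U V M x.1 x.2⟩
       map_add' := fun _ _ => rfl
       map_smul' := fun _ _ => rfl },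
     fun q => QuotientGroup.induction_on q fun _ => LinearMap.ext fun _ => Subtype.ext rfl⟩

omit [IsTopologicalGroup Γ] in
/-- Formula: `traceLayerHom` is `x ↦ x` on underlying vectors of `M`.
[cite: SerreGaloisCohomology1997, I §2.2 Proposition 8] -/
@[simp]
theorem traceLayerHom_hom_apply_coe (x : (M.obj.quotientToInvariants (V : Subgroup Γ)).V) :
    (((traceLayerHom U V M).hom x).1 : M.obj.V) = x.1 := rfl

omit [IsTopologicalGroup Γ] in
/-- `traceLayerHom` is injective. [cite: SerreGaloisCohomology1997, I §2.2 Proposition 8] -/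
theorem traceLayerHom_injective : Function.Injective (traceLayerHom U V M).hom := fun _ _ h =>
  Subtype.ext (congrArg (fun z => (z.1 : M.obj.V)) h)

omit [IsTopologicalGroup Γ] in
/-- For `V ≤ U`, `traceLayerHom` is bijective: the trace layer `(Res_U M)^{V ∩ U}` has the same vectors as
`M^V` (door-c6 `coe_traceLayer_mem_invariants`). [cite: SerreGaloisCohomology1997, I §2.2 Proposition 8] -/
theorem traceLayerHom_bijective (hVU : (V : Subgroup Γ) ≤ U) :
    Function.Bijective (traceLayerHom U V M).hom := by
  refine ⟨traceLayerHom_injective U V M, fun y => ?_⟩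
  exact ⟨⟨y.1, coe_traceLayer_mem_invariants U V M hVU y⟩, Subtype.ext rfl⟩

/-! ## §3 `Inf_V ⋙ Res_U = Res_{traceQuotMap} ⋙ Inf_{V ∩ U}` -/

/-- **`Inf_V ⋙ Res_U = Res_{U⧸(V∩U) → Γ⧸V} ⋙ Inf_{V∩U}`** as functors `Rep k (Γ ⧸ V) ⥤ C_U` (definitionally:
both send `B` to `B` with `u ∈ U` acting through `[u] ∈ Γ ⧸ V`).
[cite: SerreGaloisCohomology1997, I §2.2 Proposition 8][cite: Harari2020, §4.3 (2)] -/
theorem infFunctor_comp_resD :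
    infFunctor k (V : Subgroup Γ) (LayerColimit.coe_isOpen V) ⋙ resD k U =
      Rep.resFunctor (traceQuotMap U V) ⋙
        infFunctor k (traceOpenNormalSubgroup U V : Subgroup U)
          (LayerColimit.coe_isOpen (traceOpenNormalSubgroup U V)) := rfl

/-- **`Inf_{V∩U}(traceLayerHom) ≫ incl_{V∩U} = Res_U (incl_V)`**: both are the inclusion of the vectors of `M^V`
into `M`, as morphisms `Res_U (Inf_V (M^V)) ⟶ Res_U M` of `C_U`.
[cite: SerreGaloisCohomology1997, I §2.2 Proposition 8] -/
theorem infFunctor_map_traceLayerHom_comp_invariantsIncl :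
    (infFunctor k (traceOpenNormalSubgroup U V : Subgroup U)
          (LayerColimit.coe_isOpen (traceOpenNormalSubgroup U V))).map (traceLayerHom U V M) ≫
        invariantsIncl (traceOpenNormalSubgroup U V : Subgroup U)
          (LayerColimit.coe_isOpen (traceOpenNormalSubgroup U V)) ((resD k U).obj M) =
      (resD k U).map (invariantsIncl (V : Subgroup Γ) (LayerColimit.coe_isOpen V) M) :=
  ObjectProperty.hom_ext _ (Rep.hom_ext (DFunLike.ext _ _ fun _ => rfl))

/-! ## §4 Restriction of an inflated class, on `Ext` -/

section ExtLevel

variable (n : ℕ)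

/-- **`Res_U (Inf_V y) = Inf_{V∩U} (Res_{traceQuotMap} y ≫ traceLayerHom)`** on `Ext`: restricting to `U` a
class inflated from the layer `Γ ⧸ V` gives the class inflated (to `U`) from the layer `U ⧸ (V ∩ U)` of the
class restricted along `U ⧸ (V ∩ U) → Γ ⧸ V`.
[cite: SerreGaloisCohomology1997, I §2.2 Proposition 8][cite: Harari2020, §1.5 Definition 1.33, §4.3 (3)] -/
theorem extRes_extInf
    (y : Ext (Rep.trivial k (Γ ⧸ (V : Subgroup Γ)) k) ((invariantsQuotFunctor k (V : Subgroup Γ)).obj M) n) :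
    extRes U (triv (Γ := Γ) k) M n (extInf (V : Subgroup Γ) (LayerColimit.coe_isOpen V) M n y) =
      extInf (traceOpenNormalSubgroup U V : Subgroup U)
        (LayerColimit.coe_isOpen (traceOpenNormalSubgroup U V)) ((resD k U).obj M) n
        ((y.mapExactFunctor (Rep.resFunctor (traceQuotMap U V))).comp
          (Ext.mk₀ (traceLayerHom U V M)) (add_zero n)) := by
  haveI := comp_preservesFiniteLimits (infFunctor k (V : Subgroup Γ) (LayerColimit.coe_isOpen V)) (resD k U)
  haveI := comp_preservesFiniteColimits (infFunctor k (V : Subgroup Γ) (LayerColimit.coe_isOpen V)) (resD k U)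
  haveI := comp_preservesFiniteLimits (Rep.resFunctor (traceQuotMap U V))
    (infFunctor k (traceOpenNormalSubgroup U V : Subgroup U)
      (LayerColimit.coe_isOpen (traceOpenNormalSubgroup U V)))
  haveI := comp_preservesFiniteColimits (Rep.resFunctor (traceQuotMap U V))
    (infFunctor k (traceOpenNormalSubgroup U V : Subgroup U)
      (LayerColimit.coe_isOpen (traceOpenNormalSubgroup U V)))
  change ((y.mapExactFunctor (infFunctor k (V : Subgroup Γ) (LayerColimit.coe_isOpen V))).comp
      (Ext.mk₀ (invariantsIncl (V : Subgroup Γ) (LayerColimit.coe_isOpen V) M)) (add_zero n)).mapExactFunctor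
      (resD k U) =
    ((((y.mapExactFunctor (Rep.resFunctor (traceQuotMap U V))).comp (Ext.mk₀ (traceLayerHom U V M))
      (add_zero n)).mapExactFunctor (infFunctor k (traceOpenNormalSubgroup U V : Subgroup U)
        (LayerColimit.coe_isOpen (traceOpenNormalSubgroup U V)))).comp
      (Ext.mk₀ (invariantsIncl (traceOpenNormalSubgroup U V : Subgroup U)
        (LayerColimit.coe_isOpen (traceOpenNormalSubgroup U V)) ((resD k U).obj M))) (add_zero n))
  rw [Ext.mapExactFunctor_comp, Ext.mapExactFunctor_comp, Ext.mapExactFunctor_mk₀, Ext.mapExactFunctor_mk₀,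
    Ext.comp_assoc_of_third_deg_zero, Ext.mk₀_comp_mk₀, infFunctor_map_traceLayerHom_comp_invariantsIncl,
    ← ExtFunctoriality.mapExactFunctor_comp_functor, ← ExtFunctoriality.mapExactFunctor_comp_functor]
  rfl

end ExtLevel

/-! ## §5 Restriction of an inflated class, on the layers `Hⁿ(Γ ⧸ V, M^V)` of (d) -/

namespace LayerColimit

variable (n : ℕ)

/-- **`Res_U (Inf_V c) = Inf_{V ∩ U} (Hⁿ(traceQuotMap, traceLayerHom) c)`** for `c ∈ Hⁿ(Γ ⧸ V, M^V)`: in the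
`groupCohomology` currency of (d), restricting to the open subgroup `U` an inflated class is inflating to
`U` the image of `c` under Mathlib's `groupCohomology.map` along `U ⧸ (V ∩ U) → Γ ⧸ V` — for `V ≤ U` the
restriction map `Hⁿ(Γ ⧸ V, M^V) → Hⁿ(U ⧸ V, M^V)` of the finite layer.
[cite: SerreGaloisCohomology1997, I §2.2 Proposition 8][cite: Harari2020, §1.5 Definition 1.33, §4.3 (3)] -/
theorem extRes_inflG (c : groupCohomology ((invariantsQuotFunctor k (V : Subgroup Γ)).obj M) n) :
    extRes U (triv (Γ := Γ) k) M n (inflG V M n c) =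
      inflG (traceOpenNormalSubgroup U V) ((resD k U).obj M) n
        (groupCohomology.map (traceQuotMap U V) (traceLayerHom U V M) n c) := by
  rw [inflG_apply, inflG_apply, RepExt.extTrivialAddEquivGroupCohomology_symm_map_comp]
  exact extRes_extInf U V M n _

/-- The same read with a subgroup `V ≤ U`: then `traceLayerHom` is an isomorphism on vectors and
`traceQuotMap` identifies `U ⧸ (V ∩ U)` with the subgroup `U ⧸ V ≤ Γ ⧸ V`, so the right-hand side is the
inflation of the RESTRICTION of `c` to the subgroup `U ⧸ V` (recorded as the conjunction of `extRes_inflG` with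
the bijectivity facts, for the arithmetic files). [cite: SerreGaloisCohomology1997, I §2.2 Proposition 8] -/
theorem extRes_inflG_of_le (hVU : (V : Subgroup Γ) ≤ U)
    (c : groupCohomology ((invariantsQuotFunctor k (V : Subgroup Γ)).obj M) n) :
    extRes U (triv (Γ := Γ) k) M n (inflG V M n c) =
        inflG (traceOpenNormalSubgroup U V) ((resD k U).obj M) n
          (groupCohomology.map (traceQuotMap U V) (traceLayerHom U V M) n c) ∧
      Function.Injective (traceQuotMap U V) ∧ Function.Bijective (traceLayerHom U V M).hom :=
  ⟨extRes_inflG U V M n c, traceQuotMap_injective U V, traceLayerHom_bijective U V M hVU⟩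

end LayerColimit

end DiscreteRep

end Literature.Algebra.Homology

end
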